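import Mathlib
import Summits.CriticalPhenomena.PercolationContinuityZ3.Theses.PercNonProliferation
import Literature.Probability.Percolation.SusceptibilityGammaOne

/-!
# Sketch — crux-ideate stmt-CriticalPhenomena-4447 (FreeBoxPowerSaving), round 1, ideator 2

First lemmas of the two idea cards, stated over existing declarations (nothing below is proved
except the bookkeeping lemmas marked PROVED).

* Card `subcritical-gamma-below-two-smoothing`: `GammaBelowTwo → FreeBoxPowerSaving`
  through `FreeLeBulkSusceptibility` (AN84 / Grimmett (10.31)–(10.32)) and `CCSmoothingFA2`
  (Chayes–Chayes: box events are `n^{3/2}`-Lipschitz in `p`).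
* Card `three-replica-exit-time-defect`: `DefectMassSaving k → FreeBoxPowerSaving` through the
  exit-time identity `Σ_x u(x) = Σ_z T(z)(-Δu)(z)` for functions vanishing off the free box.
-/

namespace Summit.CriticalPhenomena.PercolationContinuityZ3.Cruxes.FreeBoxPowerSaving.Ideator2

open scoped BigOperators
open Literature.Probability.Percolation Literature.Probability.LatticeModels
open Summit.CriticalPhenomena.PercolationContinuityZ3.Theses

noncomputable section

/-- The critical bond measure on `ℤ³`. -/
abbrev μ (p : unitInterval) : MeasureTheory.Measure (BondConfig (Site 3)) :=
  bondPercolation (zdGraph 3) p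

/-- Free-box pair average `FA₂(n; p) = |B(n)|⁻² Σ_{x,y ∈ B(n)} P_p(x ↔ y inside B(n))`. -/
def FA2 (p : unitInterval) (n : ℕ) : ℝ :=
  (∑ x ∈ box 3 n, ∑ y ∈ box 3 n, (μ p).real (openConnIn (↑(box 3 n) : Set (Site 3)) x y)) /
    ((box 3 n).card : ℝ) ^ 2

/-- PROVED (definitional): the crux is `∃ a > 0, C, ∀ n ≥ 1, FA₂(n; p_c) ≤ C n^{-a}`. -/
theorem crux_iff :
    PercNonProliferation.FreeBoxPowerSaving ↔
      ∃ a C : ℝ, 0 < a ∧ ∀ n : ℕ, 1 ≤ n → FA2 (criticalProbI 3) n ≤ C * (n : ℝ) ^ (-a) :=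
  Iff.rfl

/-! ## Card B: subcritical-gamma-below-two-smoothing -/

/-- `C⁺` of card B (OPEN; a classical subcritical exponent inequality): the susceptibility
`χ(p) = Σ_x τ_p(0,x)` blows up at most like `(p_c - p)^{-γ}` with SOME `γ < 2`
(`γ(ℤ³) = ν(2-η) ≈ 1.79` numerically; mean-field `γ = 1`; `d = 2`: `43/18 > 2`). -/
def GammaBelowTwo : Prop :=
  ∃ γ C : ℝ, γ < 2 ∧ 0 < C ∧ ∀ p : unitInterval, (p : ℝ) < (criticalProbI 3 : ℝ) →
    chi 3 p ≤ C * ((criticalProbI 3 : ℝ) - p) ^ (-γ)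

/-- Support (provable now, AN84 / Grimmett (10.31)–(10.32)): the free-box pair average at `p < p_c`
is at most `χ(p)/|B(n)|` (`E_p|C_{B(n)}(x)| ≤ E_p|C(x)| = χ(p)`). -/
def FreeLeBulkSusceptibility : Prop :=
  ∀ (p : unitInterval) (n : ℕ), (p : ℝ) < (criticalProbI 3 : ℝ) →
    FA2 p n ≤ chi 3 p / ((box 3 n).card : ℝ)

/-- Support (provable now, Chayes–Chayes 1986 / DKT 2020 §8): for every event `A` depending on the
edges of `B(n)` only, `|d/dp √P_p(A)| ≤ ½ √(|E(B(n))| / (p(1-p)))` (Russo's formula as a covariance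
with the number of open edges + Cauchy–Schwarz with `Var 1_A ≤ P(A)`); averaged over the pairs
`(x,y)` and squared it gives the displayed smoothing inequality for `FA₂` on `[1/6, 63/64]`
(which contains `[p_c - δ, p_c]`: `1/5 ≤ p_c(ℤ³) ≤ 63/64`, `criticalProb_zd_ge_inv`,
`criticalProb_zd_le`). -/
def CCSmoothingFA2 : Prop :=
  ∃ C : ℝ, 0 < C ∧ ∀ (p q : unitInterval) (n : ℕ), 1 ≤ n → (1 : ℝ) / 6 ≤ (p : ℝ) → p ≤ q →
    (q : ℝ) ≤ 63 / 64 → FA2 q n ≤ 2 * FA2 p n + C * (n : ℝ) ^ (3 : ℝ) * ((q : ℝ) - p) ^ 2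

/-- FIRST LEMMA of card B (provable now from the two supports; pure real analysis: take
`p = p_c - δ`, `δ = n^{-6/(2+γ)}`, giving `FA₂(n; p_c) ≤ C' n^{-3(2-γ)/(2+γ)}`). -/
def FirstLemmaB : Prop :=
  FreeLeBulkSusceptibility → CCSmoothingFA2 → GammaBelowTwo → PercNonProliferation.FreeBoxPowerSaving

/-- The explicit exponent of card B. -/
def GammaTransferExplicit : Prop :=
  FreeLeBulkSusceptibility → CCSmoothingFA2 →
    ∀ γ C : ℝ, 0 < C → γ < 2 →
      (∀ p : unitInterval, (p : ℝ) < (criticalProbI 3 : ℝ) →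
        chi 3 p ≤ C * ((criticalProbI 3 : ℝ) - p) ^ (-γ)) →
      ∃ C' : ℝ, ∀ n : ℕ, 1 ≤ n →
        FA2 (criticalProbI 3) n ≤ C' * (n : ℝ) ^ (-(3 * (2 - γ) / (2 + γ)))

/-- The general (exponent-free) criterion behind card B: ANY subcritical susceptibility bound
plugs in. -/
def SmoothingCriterion : Prop :=
  FreeLeBulkSusceptibility → CCSmoothingFA2 →
    ∃ C : ℝ, ∀ (n : ℕ) (p : unitInterval), 1 ≤ n → (1 : ℝ) / 6 ≤ (p : ℝ) →
      (p : ℝ) < (criticalProbI 3 : ℝ) →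
        FA2 (criticalProbI 3) n ≤ 2 * chi 3 p / ((box 3 n).card : ℝ) +
          C * (n : ℝ) ^ (3 : ℝ) * ((criticalProbI 3 : ℝ) - p) ^ 2

/-! ## Card A: three-replica-exit-time-defect -/

/-- In-box two-point function from the centre of the free box `Λ_R = box 3 R`. -/
def tauBox (R : ℕ) (y : Site 3) : ℝ :=
  (μ (criticalProbI 3)).real (openConnIn (↑(box 3 R) : Set (Site 3)) 0 y)

/-- Discrete (probabilistic) negative Laplacian `(-Δu)(z) = u(z) - (1/6) Σ_{y ∼ z} u(y)` on `ℤ³`. -/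
def negLap (u : Site 3 → ℝ) (z : Site 3) : ℝ :=
  u z - (1 / 6 : ℝ) * ∑ i : Fin 3, (u (z + Pi.single i 1) + u (z - Pi.single i 1))

/-- The `k`-replica function `u_k = τ_B(0,·)^k`, extended by `0` off the box (free b.c. = zero
Dirichlet data: `openConnIn` forces `y ∈ box`). -/
def uRep (k R : ℕ) (y : Site 3) : ℝ := tauBox R y ^ k

/-- Defect mass `M_k(R) = Σ_{z ∈ Λ_R} (-Δ u_k)⁺(z)` — the total superharmonic defect of `τ_B^k`. -/
def defectMass (k R : ℕ) : ℝ :=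
  ∑ z ∈ box 3 R, max 0 (negLap (uRep k R) z)

/-- Support (provable now; discrete Green's second identity on `ℤ³` for finitely supported
functions): if `u` and `T` vanish off `Λ_R` and `(-ΔT) = 1` on `Λ_R` (`T` = SRW exit time of the
box), then `Σ_{x ∈ Λ_R} u(x) = Σ_{z ∈ Λ_R} T(z) (-Δu)(z)`. -/
def ExitTimeIdentity : Prop :=
  ∀ (R : ℕ) (u T : Site 3 → ℝ), (∀ z, z ∉ box 3 R → u z = 0) → (∀ z, z ∉ box 3 R → T z = 0) →
    (∀ z ∈ box 3 R, negLap T z = 1) →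
      ∑ x ∈ box 3 R, u x = ∑ z ∈ box 3 R, T z * negLap u z

/-- Support (provable now; existence of the exit time and the bound `0 ≤ T ≤ 3(R+1)²`, by comparison
with the slab exit time `3((R+1)² - z₀²)`). -/
def ExitTimeBound : Prop :=
  ∀ R : ℕ, ∃ T : Site 3 → ℝ, (∀ z, z ∉ box 3 R → T z = 0) ∧ (∀ z ∈ box 3 R, negLap T z = 1) ∧
    ∀ z, 0 ≤ T z ∧ T z ≤ 3 * ((R : ℝ) + 1) ^ 2

/-- `C⁺_k` of card A (OPEN): the superharmonic defect of `τ_B^k` has total mass `≤ C R^{1-δ}`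
(prediction: `O(1)` for `k = 3`, supported on an `O(1)` core; `≈ R^{0.05}` for `k = 1`). -/
def DefectMassSaving (k : ℕ) : Prop :=
  ∃ δ C : ℝ, 0 < δ ∧ ∀ R : ℕ, 1 ≤ R → defectMass k R ≤ C * (R : ℝ) ^ (1 - δ)

/-- FIRST LEMMA of card A (provable now from the two supports + the power-mean inequality:
`Σ τ^k ≤ 3(R+1)² M_k ≤ C R^{3-δ}`, `Σ τ ≤ (Σ τ^k)^{1/k} |Λ_R|^{1-1/k} ≤ C' R^{3-δ/k}`, then the
grounded bridge centred ⇒ pair-averaged (`FA₂(n) ≤ 8 F(2n)`, item note g13-41)). -/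
def FirstLemmaA : Prop :=
  ExitTimeIdentity → ExitTimeBound → ∀ k : ℕ, 1 ≤ k → DefectMassSaving k →
    PercNonProliferation.FreeBoxPowerSaving

/-- Equivalent two-replica reading used in the card (bookkeeping, provable now by Cauchy–Schwarz
both ways): the crux holds iff the expected INTERSECTION of two independent critical free-box
clusters of the centre has a power saving, `Σ_y τ_B(0,y)² ≤ C R^{3-ε}`. -/
def TwoReplicaIntersectionForm : Prop :=
  PercNonProliferation.FreeBoxPowerSaving ↔
    ∃ ε C : ℝ, 0 < ε ∧ ∀ R : ℕ, 1 ≤ R → ∑ y ∈ box 3 R, tauBox R y ^ 2 ≤ C * (R : ℝ) ^ (3 - ε)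

end

end Summit.CriticalPhenomena.PercolationContinuityZ3.Cruxes.FreeBoxPowerSaving.Ideator2
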